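import Literature.NumberTheory.EllipticCurves.KellerYin2024.PotentiallyGoodOrdinaryIwasawaTheory
import HarnessLib

/-!
# Keller–Yin (arXiv:2410.23241) Conjecture 0.1.1 — the rank-`r` `p`-CONVERSE to Gross–Zagier–Kolyvagin,
# "`corank_{ℤ_p} Sel_{p^∞}(E/ℚ) = r ⟹ ord_{s=1} L(E,s) = r`" for EVERY `E/ℚ`, EVERY prime `p`, EVERY `r`
# — TYPED as a conjecture leaf (nothing asserted), with its kernel bookkeeping PROVED

STAGED by the cross-ladder literature-typing layer (cell `bsd-littype`, seat 06, gen-2 successor;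
D-0088(4); HOME `run/shared/lean/pub/bsd-littype/`, OPEN-QUESTIONS-06 Q-A6) for planners:
conjectures are not Literature (CONVENTIONS §4; a Literature `def X : Prop` must cite a source that
PROVES `X`), so the one conjecture Keller–Yin STATE (and prove a cell of) is filed here, next to the
rank-`≤ 1` residual programme whose `p`-converse cells (X1–X12, additive X3/X4, `p = 2` X5) are all
instances of it, in the exact currency of every `p`-converse fact of the tree (`W.selmerCorank p`,
`W.analyticRank`). HONEST FRAMING (cell, verbatim): "no tranche here proves BSD; … typed ≠ proved ≠
endorsed". Nothing in this file is asserted: two `@[conjecture]` predicates and PROVED edges.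

## The printed statement (T. Keller, M. Yin, arXiv:2410.23241v1 (2024-10-30, PREPRINT), §0.1, held
LaTeXML text `paper:arxiv-2410.23241`, chunk p0003 L25–L33)

"The implication (iii)⟹(i) is usually called the `p`-converse to Gross–Zagier–Kolyvagin's theorem,
which can be formulated in the following way. **Conjecture 0.1.1.** Let `E` be an elliptic curve
defined over `ℚ` and let `p` be a prime. Let `r ∈ ℤ`. Then
`corank_{ℤ_p} Sel_{p^∞}(E/ℚ) = r ⟹ ord_{s=1} L(E,s) = r`."
(with (i) `ord_{s=1} L(E,s) = r`, (iii) `corank_{ℤ_p} Sel_{p^∞}(E/ℚ) = r`, p0003 L12–L16; `r < 0` is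
vacuous, so `r : ℕ` below). Context (p0003 L35–L37): "When `r ∈ {0,1}`, many important cases of the
`p`-converse theorems have been essentially obtained, most of which only allow `p` to be a prime of
ordinary reduction or good supersingular reduction for `E`."

## What this file declares

* `SelmerCorankPConverseAt W p r` — the conjecture AT a pair `(E, p)` and a rank `r` (the shape of
  the conclusion of every `p`-converse fact in the tree); `kellerYin2024_conjecture_0_1_1` — the
  printed sentence (all `E`, all `p`, all `r`). Both `@[conjecture]`, nothing asserted.
* PROVED edges (kernel bookkeeping, no new mathematics):
  (1) `selmerCorankPConverseAt_of_rank_eq_of_finite_sha` — the conjecture at `(E, p, r)` for every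
  `p` and `r` FOLLOWS from the rank part of BSD for `E` together with `#Ш(E/ℚ) < ∞` (indeed from
  `#Ш(E/ℚ)[p^∞] < ∞`): then `corank_{ℤ_p} Sel_{p^∞}(E/ℚ) = rk E(ℚ)` (tree theorem
  `selmerCorank_eq_mordellWeilRank_of_finite_shaPrimary`, Greenberg 1999 §1) `= ord_{s=1} L(E,s)`;
  (2) `analyticRank_le_one_iff_selmerCorank_le_one_of_conj` — granted the conjecture at `(E,p)` for
  `r = 0, 1`, "`ord_{s=1} L(E,s) ≤ 1 ⟺ corank_{ℤ_p} Sel_{p^∞}(E/ℚ) ≤ 1`", the forward direction being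
  Kolyvagin's THEOREM 2.5.1 of the paper (tree: `KellerYin2024.thm251_selmerCorank_eq_of_analyticRank_eq`,
  proved from the Gross–Zagier–Kolyvagin fact `rank_eq_analyticRank_of_analyticRank_le_one`);
  (3) instances in print, re-pointed at the leaf: Keller–Yin Thm. 0.1.2 (claim `thm012_…`, `p > 2`
  potentially good ordinary Eisenstein, `r ≤ 1`) and Castella–Grossi–Lee–Skinner 2022 Thm. E
  (REFEREED, good Eisenstein non-anomalous `p > 2`, `r ≤ 1`) each give `SelmerCorankPConverseAt`
  on their cell (`…_of_thm012`, `…_of_thmE_one`, `…_of_thmE_zero`).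

Consumers named in OPEN-QUESTIONS-06 Q-A6: rank-2 cells (`Summits/BirchSwinnertonDyer/Rank2*`: the
conjecture at `r = 2` is the `p`-adic door to "analytic rank 2"), every `p`-converse route (e.g.
`GoldfeldAllTwistsTwoConverse` at `p = 2`, where Thm. 0.1.2 is silent), the partition's residual
cells. A planner who wants it under `Summits/BirchSwinnertonDyer/BirchSwinnertonDyer/Theorems/` as a
crux / `--conditional-on` leaf should MOVE this file, not restate it.

## References
* [KellerYin2024PotOrd] T. Keller, M. Yin, arXiv:2410.23241v1: Conj. 0.1.1 (§0.1, p0003 L27–L33),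
  Thm. 0.1.2 (p0003 L39–L47), Thm. 2.5.1 (p0012 L50–L53).
* [CastellaGrossiLeeSkinner2022] Invent. Math. 227 (2022), Thm. E (tree `CastellaGrossiLeeSkinner2022.thmE_…`).
* [Greenberg1999] R. Greenberg, LNM 1716, §1 (corank identity; tree theorem
  `selmerCorank_eq_mordellWeilRank_of_finite_shaPrimary`).
* [Darmon2004] Thm. 3.22 (Gross–Zagier–Kolyvagin; tree fact `rank_eq_analyticRank_of_analyticRank_le_one`).
-/

noncomputable section

open scoped Classical

open WeierstrassCurve Literature.NumberTheory.EllipticCurves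
  Literature.NumberTheory.EllipticCurves.Rank1Residual
  Literature.NumberTheory.EllipticCurves.KellerYin2024

namespace Summit.BirchSwinnertonDyer.Rank1Residual.PConverse

/-- **Keller–Yin Conjecture 0.1.1 AT `(E, p, r)` — TYPED**: for the elliptic curve `E = W/ℚ`, the
prime `p` and `r : ℕ`, "`corank_{ℤ_p} Sel_{p^∞}(E/ℚ) = r ⟹ ord_{s=1} L(E,s) = r`" (`W.selmerCorank p`,
`W.analyticRank`: the currency of every `p`-converse fact of the tree). A predicate; nothing
asserted; OPEN in general (known cells: `r ≤ 1` at ordinary / good supersingular / potentially good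
ordinary Eisenstein primes, see the edges below and OPEN-QUESTIONS-06).
[cite: KellerYin2024PotOrd, Conj. 0.1.1 (§0.1, held chunk p0003 L27–L33)] -/
@[conjecture] def SelmerCorankPConverseAt (W : WeierstrassCurve ℚ) (p : ℕ) (r : ℕ) : Prop :=
  W.selmerCorank p = r → W.analyticRank = r

/-- **Keller–Yin, arXiv:2410.23241, Conjecture 0.1.1 (the rank-`r` `p`-converse to
Gross–Zagier–Kolyvagin), verbatim**: "Let `E` be an elliptic curve defined over `ℚ` and let `p` be a
prime. Let `r ∈ ℤ`. Then `corank_{ℤ_p} Sel_{p^∞}(E/ℚ) = r ⟹ ord_{s=1} L(E,s) = r`." (`r < 0` is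
vacuous: `r : ℕ`.) A conjecture STATED, not proved, by the source; nothing asserted here.
[cite: KellerYin2024PotOrd, Conj. 0.1.1 (§0.1, held chunk p0003 L27–L33)] -/
@[conjecture] def kellerYin2024_conjecture_0_1_1 : Prop :=
  ∀ (W : WeierstrassCurve ℚ) [W.IsElliptic] (p : ℕ) [Fact p.Prime] (r : ℕ),
    SelmerCorankPConverseAt W p r

variable {W : WeierstrassCurve ℚ} {p : ℕ}

/-- Unfolding lemma. [cite: KellerYin2024PotOrd, Conj. 0.1.1] -/
theorem selmerCorankPConverseAt_iff {r : ℕ} :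
    SelmerCorankPConverseAt W p r ↔ (W.selmerCorank p = r → W.analyticRank = r) :=
  Iff.rfl

/-! ### (1) BSD (rank part) + `#Ш(E/ℚ)[p^∞] < ∞` ⟹ the conjecture at every `p` and `r` — PROVED -/

/-- **The rank part of BSD for `E` together with the finiteness of `Ш(E/ℚ)[p^∞]` implies
Conjecture 0.1.1 at `(E, p, r)` for every `r`**: `corank_{ℤ_p} Sel_{p^∞}(E/ℚ) = rk E(ℚ)` when
`Ш[p^∞]` is finite (Greenberg's corank identity, tree theorem
`selmerCorank_eq_mordellWeilRank_of_finite_shaPrimary`), and `rk E(ℚ) = ord_{s=1} L(E,s)` by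
hypothesis. So the leaf is a CONSEQUENCE of the summit (with `Ш` finite), as the source says
((iii) ⟸ (ii) ⟸ (i), p0003 L17–L23). [cite: KellerYin2024PotOrd, §0.1 (p0003 L12–L25)]
[cite: GreenbergLNM1716, §1 (corank identity)] -/
theorem selmerCorankPConverseAt_of_rank_eq_of_finite_sha [W.IsElliptic] [Fact p.Prime]
    (hrk : W.mordellWeilRank = W.analyticRank)
    (hsha : Finite (AddCommGroup.primaryComponent W.sha p)) (r : ℕ) :
    SelmerCorankPConverseAt W p r := by
  intro hcork
  rw [← hrk, ← selmerCorank_eq_mordellWeilRank_of_finite_shaPrimary W p hsha]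
  exact hcork

/-- The same with `#Ш(E/ℚ) < ∞` (all of `Ш`). [cite: KellerYin2024PotOrd, §0.1 (p0003 L12–L25)] -/
theorem selmerCorankPConverseAt_of_rank_eq_of_finite_sha' [W.IsElliptic] [Fact p.Prime]
    (hrk : W.mordellWeilRank = W.analyticRank) (hsha : Finite W.sha) (r : ℕ) :
    SelmerCorankPConverseAt W p r :=
  selmerCorankPConverseAt_of_rank_eq_of_finite_sha hrk inferInstance r

/-! ### (2) With Kolyvagin (Thm. 2.5.1): the conjecture at `r ∈ {0,1}` makes "rank ≤ 1" `p`-adically decidable -/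

/-- **Granted Conjecture 0.1.1 at `(E, p)` for `r = 0` and `r = 1`: `ord_{s=1} L(E,s) ≤ 1 ⟺
corank_{ℤ_p} Sel_{p^∞}(E/ℚ) ≤ 1`.** (⟹) is Kolyvagin's THEOREM 2.5.1 of the paper for any prime
(tree: `KellerYin2024.thm251_selmerCorank_eq_of_analyticRank_eq`, proved from the
Gross–Zagier–Kolyvagin fact `hGZK`); (⟸) is the conjecture. [cite: KellerYin2024PotOrd, Thm. 2.5.1 (p0012 L50–L53) and Conj. 0.1.1] -/
theorem analyticRank_le_one_iff_selmerCorank_le_one_of_conj [W.IsElliptic] [Fact p.Prime]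
    (hGZK : rank_eq_analyticRank_of_analyticRank_le_one)
    (h0 : SelmerCorankPConverseAt W p 0) (h1 : SelmerCorankPConverseAt W p 1) :
    W.analyticRank ≤ 1 ↔ W.selmerCorank p ≤ 1 := by
  constructor
  · intro h
    rcases Nat.le_one_iff_eq_zero_or_eq_one.mp h with h' | h'
    · rw [thm251_selmerCorank_eq_of_analyticRank_eq hGZK W p (Or.inl rfl) h']; exact Nat.zero_le 1
    · rw [thm251_selmerCorank_eq_of_analyticRank_eq hGZK W p (Or.inr rfl) h']
  · intro h
    rcases Nat.le_one_iff_eq_zero_or_eq_one.mp h with h' | h'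
    · rw [h0 h']; exact Nat.zero_le 1
    · rw [h1 h']

/-- **Granted the conjecture at `(E, p, r)` with `r ≤ 1`, its full printed consequence**:
`corank_{ℤ_p} Sel_{p^∞}(E/ℚ) = r ⟹ ord_{s=1} L(E,s) = r`, `rk E(ℚ) = r` and `#Ш(E/ℚ) < ∞` (by
Gross–Zagier–Kolyvagin, `hGZK`) — the shape "and so `rk_ℤ E(ℚ) = r` and `Ш(E/ℚ) < ∞`" of Thm. 0.1.2.
[cite: KellerYin2024PotOrd, Thm. 0.1.2 (p0003 L39–L47)] -/
theorem rank_eq_and_finite_sha_of_conj [W.IsElliptic] [Fact p.Prime]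
    (hGZK : rank_eq_analyticRank_of_analyticRank_le_one) {r : ℕ} (hr : r ≤ 1)
    (h : SelmerCorankPConverseAt W p r) (hcork : W.selmerCorank p = r) :
    W.analyticRank = r ∧ W.mordellWeilRank = r ∧ Finite W.sha := by
  have hra : W.analyticRank = r := h hcork
  obtain ⟨hrk, hfin⟩ := hGZK W (hra ▸ hr)
  exact ⟨hra, hrk.trans hra, hfin⟩

/-! ### (3) Cells of the conjecture that are claims / theorems in print, re-pointed at the leaf -/

/-- **Keller–Yin Thm. 0.1.2 (claim AS STATED, `thm012_…`) is Conjecture 0.1.1 on its cell**: `p > 2`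
of potentially good ordinary reduction, `E[p]` reducible, `r ∈ {0,1}`. CONDITIONAL on the unrefereed
claim; nothing asserted. [claim: KellerYin2024PotOrd, status: under-review] -/
theorem selmerCorankPConverseAt_of_thm012 [W.IsElliptic] [Fact p.Prime]
    (h : thm012_analyticRank_eq_of_selmerCorank_eq) (hp : 2 < p)
    (hpot : W.HasPotentiallyGoodOrdinaryReductionAtPrime p) (hred : Red W p) {r : ℕ}
    (hr : r = 0 ∨ r = 1) : SelmerCorankPConverseAt W p r :=
  fun hcork ↦ h W p hp hpot hred r hr hcork

/-- **Keller–Yin Thm. 3.7.1 at the scope of its printed proof (Case (I), `thm371_pConverse_caseOne_OPEN`)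
is Conjecture 0.1.1 on its cell** (`e ≤ 2`). CONDITIONAL on the unrefereed claim; nothing asserted.
[claim: KellerYin2024PotOrd, status: under-review] -/
theorem selmerCorankPConverseAt_of_thm371_caseOne [W.IsElliptic] [Fact p.Prime]
    (h : thm371_pConverse_caseOne_OPEN) (hp : 2 < p)
    (hI : W.HasGoodOrdinaryReductionOverQuadraticAt p) (hred : Red W p) {r : ℕ}
    (hr : r = 0 ∨ r = 1) : SelmerCorankPConverseAt W p r :=
  fun hcork ↦ h W p hp hI hred r hr hcork

/-- **Castella–Grossi–Lee–Skinner 2022 Thm. E, `r = 1` (REFEREED; tree fact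
`CastellaGrossiLeeSkinner2022.thmE_analyticRank_eq_one_of_selmerCorank_eq_one`) is Conjecture 0.1.1
at `(E, p, 1)` on its cell**: `p > 2` good Eisenstein non-anomalous.
[cite: CastellaGrossiLeeSkinner2022, Theorem E = Thm. 5.2.1 (r = 1)] -/
theorem selmerCorankPConverseAt_one_of_thmE [W.IsElliptic] [W.IsGloballyMinimal] [Fact p.Prime]
    (h : CastellaGrossiLeeSkinner2022.thmE_analyticRank_eq_one_of_selmerCorank_eq_one) (hp : 2 < p)
    (hgood : Good W p) (hred : Red W p) (hna : ¬ Anom W p) : SelmerCorankPConverseAt W p 1 :=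
  fun hcork ↦ h W p hp hgood hred hna hcork

/-- **Castella–Grossi–Lee–Skinner 2022 Thm. E, `r = 0`** (tree fact
`CastellaGrossiLeeSkinner2022.thmE_analyticRank_eq_zero_of_selmerCorank_eq_zero`) is Conjecture
0.1.1 at `(E, p, 0)` on its cell. [cite: CastellaGrossiLeeSkinner2022, Theorem E = Thm. 5.2.1 (r = 0)] -/
theorem selmerCorankPConverseAt_zero_of_thmE [W.IsElliptic] [W.IsGloballyMinimal] [Fact p.Prime]
    (h : CastellaGrossiLeeSkinner2022.thmE_analyticRank_eq_zero_of_selmerCorank_eq_zero) (hp : 2 < p)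
    (hgood : Good W p) (hred : Red W p) (hna : ¬ Anom W p) : SelmerCorankPConverseAt W p 0 :=
  fun hcork ↦ h W p hp hgood hred hna hcork

/-- **The printed sentence implies every cell** (trivial specialisation; recorded so that a route
opened `--conditional-on kellerYin2024_conjecture_0_1_1` can feed any `p`-converse-shaped item).
[cite: KellerYin2024PotOrd, Conj. 0.1.1] -/
theorem selmerCorankPConverseAt_of_conjecture (h : kellerYin2024_conjecture_0_1_1)
    (W : WeierstrassCurve ℚ) [W.IsElliptic] (p : ℕ) [Fact p.Prime] (r : ℕ) :
    SelmerCorankPConverseAt W p r :=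
  h W p r

end Summit.BirchSwinnertonDyer.Rank1Residual.PConverse

end
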